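import Summits.Parity.GeneralizedHardyLittlewood.Theses.LiouvilleShiftedTables
import Summits.Parity.GeneralizedHardyLittlewood.Theorems.LiouvilleShiftedTablesDilatedTableChowlaQuarantine
import Summits.Parity.GeneralizedHardyLittlewood.Theorems.DilatedTableChowla.Negative.DilatedTableChowlaOffDiagonal
import Summits.Parity.GeneralizedHardyLittlewood.Theorems.DilatedTableChowla.Negative.DilatedTableChowlaPointwise
import Summits.Parity.GeneralizedHardyLittlewood.Theorems.DilatedTableChowla.Negative.DilatedTableChowlaLoadBearing
import Summits.Parity.GeneralizedHardyLittlewood.Theorems.TableChowla.Negative.TableChowlaExceptionalSet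

/-!
# `DilatedTableChowla` (stmt-Parity-14271) is SANDWICHED between two conjecture-grade statements

Support file for the crux `LiouvilleShiftedTables.DilatedTableChowla` (route LiouvilleShiftedTables,
X1; lead prover c2 of the line `positivity-quarantine`).  Def-free RESISTANCE CALIBRATION of the crux,
answering the third clause of its why-might-fail ("one structured bad class `(u,v)` per `q` breaks the
sup") the way the landed quarantine (`Quarantine.dilatedTableChowla_of_genericAffineTable`) answered the
first (Siegel moduli):

* `dilatedTableChowla_of_genericUniformBinaryChowlaAP` — the crux FOLLOWS from the hypothesis
  "GenericUniformBinaryChowlaAP" (written out in the statement): for every shift `c ≠ 0` and every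
  `C` there are one-point parameters `B, κ` such that, beyond some `x₀`, at every dilation
  `q ≤ x^{1/24}` CARRYING SIEGEL–WALFISZ-QUALITY ONE-POINT DATA (`(log x)^B`-saving character sums of
  `λ` to all moduli `q·m ≤ q (log x)^κ` on `[x^{1/2}, x²]` — exactly the antecedent of the registered
  stub (C⁺) `GenericAffineTable`), the two-point Chowla–Elliott sum of `λ` at the NON-PROPORTIONAL
  binary forms `ab+c, a'b+c` (`1 ≤ a ≠ a' ≤ 2x^{5/12}`, `a ≡ a' (mod q)`, determinant `c(a−a') ≠ 0`) along the
  progression `b ≡ v (mod q)`, `b ≤ X ∈ [x^{7/12}, x]`, saves `(log x)^C`: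
  `|Σ_{b ≤ X, b ≡ v (q)} λ(ab+c)λ(a'b+c)| ≤ X/(q (log x)^C)`, uniformly in `a, a', v`.  A standard,
  believed, open conjecture of Chowla–Elliott type, asked only at "generic" dilations, so that the one
  KNOWN mechanism for a biased class-restricted correlation — `λ` pretending to be a real character of
  conductor dividing `q·m` (Landau–Siegel scenario; Tao–Teräväinen arXiv:2109.06291) — is excluded by
  the antecedent.  Proof: at such a dilation every off-diagonal `|S(a,a')| ≤ (x/A)/(q (log x)^{C+2})`,
  so `q⁴ Foff ≤ 9x²/(log x)^{2C+4}`, the diagonal gives `q⁴ diagF ≤ 12 x² q/A ≤ 12x²/x^{δ/2}`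
  (`Negative.window_counts`), hence `q⁴F ≤ x²/(log x)^C` pointwise with EMPTY exceptional set, which is
  the stub (C⁺); the quarantine composition `Quarantine.dilatedTableChowla_of_genericAffineTable`
  (all inputs landed: classical zero-free region + Siegel, Bombieri's log-free density theorem, the
  Linnik-box one-point transfer) turns (C⁺) into the crux.
* `dilatedTableChowla_of_uniformBinaryChowlaAP` — a fortiori from the PLAIN hypothesis (the same
  two-point bound at every `q ≤ x^{1/24}`, no one-point antecedent; pointwise in `q` it is
  Landau–Siegel-hard to PROVE but equally believed).
* `fixedResidueFace_of_dilatedTableChowla` — upper side of the sandwich, by composition of landed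
  results: the crux implies its `q = 1` slice `TableChowla` (`Negative.crux_imp_tableChowla`), which
  implies `TableChowla.Negative.FixedResidueFace` (p71931): fixed-residue, absolute-value level of
  distribution `x^{1−δ}` for `λ` for every `δ ∈ (0, 1/12]` and every log-power saving — beyond the
  reach of GRH (segments of `x^δ < x^{1/2}` terms).

Consequence for the planners: GenericUniformBinaryChowlaAP ⟹ DilatedTableChowla ⟹ FixedResidueFace;
a refutation of the crux through a "bad class" refutes a Siegel-free Chowla–Elliott conjecture, and a
proof of the crux proves a beyond-GRH distribution statement for `λ`: the item is conjecture-grade on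
both sides (cf. `Cruxes/TableChowla/IDEATOR5-REPORT.md`, F1), kernel-checked here for 14271 itself.
All statements are in the crux's own vocabulary (no new definitions). [folklore]
-/

noncomputable section

namespace Summit.Parity.GeneralizedHardyLittlewood.Theorems.DilatedTableChowla.Resistance

open Finset
open Summit.Parity.GeneralizedHardyLittlewood.Theses.LiouvilleShiftedTables
open Summit.Parity.GeneralizedHardyLittlewood.Theorems.DilatedTableChowla.Negative

/-! ### §1 Window bookkeeping and the off-diagonal block bound -/

/-- Real-variable facts about the crux's window: for `x ≥ 1`, `0 < δ ≤ 1/12`,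
`x^δ ≤ A ≤ x^{1/3+δ}` and `1 ≤ q ≤ ⌊x^{δ/2}⌋` one has `q ≤ x^{1/24}`, `x^{7/12} ≤ x/A ≤ x`,
and every row `a ∈ rows A q u` satisfies `1 ≤ a` and `a ≤ 2 x^{5/12}`. -/
theorem window_real {δ x A : ℝ} (hδ : 0 < δ) (hδ' : δ ≤ 1 / 12) (hx : 1 ≤ x) (hA1 : x ^ δ ≤ A)
    (hA2 : A ≤ x ^ (1 / 3 + δ)) {q : ℕ} (hq2 : q ≤ ⌊x ^ (δ / 2)⌋₊) (u : ℕ) :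
    (q : ℝ) ≤ x ^ (1 / 24 : ℝ) ∧ x ^ (7 / 12 : ℝ) ≤ x / A ∧ x / A ≤ x ∧
      ∀ a ∈ rows A q u, 1 ≤ a ∧ (a : ℝ) ≤ 2 * x ^ (5 / 12 : ℝ) := by
  have hxpos : 0 < x := by linarith
  have h1A : 1 ≤ A := le_trans (Real.one_le_rpow hx hδ.le) hA1
  have hApos : 0 < A := by linarith
  have hqx : (q : ℝ) ≤ x ^ (δ / 2) := by
    have := Nat.floor_le (Real.rpow_nonneg hxpos.le (δ / 2))
    exact le_trans (by exact_mod_cast hq2) this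
  have hA512 : A ≤ x ^ (5 / 12 : ℝ) :=
    hA2.trans (Real.rpow_le_rpow_of_exponent_le hx (by linarith))
  refine ⟨hqx.trans (Real.rpow_le_rpow_of_exponent_le hx (by linarith)), ?_, ?_, ?_⟩
  · -- x^{7/12} ≤ x/A since A ≤ x^{5/12}
    rw [le_div_iff₀ hApos]
    calc x ^ (7 / 12 : ℝ) * A ≤ x ^ (7 / 12 : ℝ) * x ^ (5 / 12 : ℝ) := by gcongr
      _ = x := by
          rw [← Real.rpow_add hxpos]; norm_num
  · rw [div_le_iff₀ hApos]; nlinarith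
  · intro a ha
    rw [mem_rows] at ha
    refine ⟨by omega, ?_⟩
    have h2 : (a : ℝ) ≤ (⌊2 * A⌋₊ : ℝ) := by exact_mod_cast ha.1.2
    have h3 : (⌊2 * A⌋₊ : ℝ) ≤ 2 * A := Nat.floor_le (by linarith)
    linarith [mul_le_mul_of_nonneg_left hA512 (by norm_num : (0 : ℝ) ≤ 2)]

/-- If every OFF-diagonal two-row correlation of the `(q;u,v)` block is at most `ε`, then
`Foff ≤ #rows² · ε²`. -/
theorem Foff_le_of_offdiag (c : ℤ) (x A : ℝ) (q u v : ℕ) {ε : ℝ}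
    (h : ∀ a ∈ rows A q u, ∀ a' ∈ rows A q u, a ≠ a' → |S c x A q v a a'| ≤ ε) :
    Foff c x A q u v ≤ ((rows A q u).card : ℝ) ^ 2 * ε ^ 2 := by
  unfold Foff
  have hrow : ∀ a ∈ rows A q u, ∑ a' ∈ (rows A q u).erase a, (S c x A q v a a') ^ 2 ≤
      ((rows A q u).card : ℝ) * ε ^ 2 := by
    intro a ha
    calc ∑ a' ∈ (rows A q u).erase a, (S c x A q v a a') ^ 2
        ≤ ∑ _a' ∈ (rows A q u).erase a, ε ^ 2 := by
          refine sum_le_sum fun a' ha' => ?_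
          have hne : a ≠ a' := (Finset.ne_of_mem_erase ha').symm
          have hmem : a' ∈ rows A q u := Finset.mem_of_mem_erase ha'
          have hb := h a ha a' hmem hne
          exact sq_le_sq' (by linarith [(abs_le.mp hb).1]) (abs_le.mp hb).2
      _ ≤ ∑ _a' ∈ rows A q u, ε ^ 2 :=
          sum_le_sum_of_subset_of_nonneg (erase_subset _ _) (fun _ _ _ => sq_nonneg _)
      _ = ((rows A q u).card : ℝ) * ε ^ 2 := by simp
  calc ∑ a ∈ rows A q u, ∑ a' ∈ (rows A q u).erase a, (S c x A q v a a') ^ 2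
      ≤ ∑ _a ∈ rows A q u, ((rows A q u).card : ℝ) * ε ^ 2 := sum_le_sum hrow
    _ = ((rows A q u).card : ℝ) ^ 2 * ε ^ 2 := by
        rw [sum_const, nsmul_eq_mul]; ring

/-- The two-row correlation `S` of `DilatedTableChowlaBlocks`, unfolded to the crux's own sum. -/
theorem S_eq_sum (c : ℤ) (x A : ℝ) (q v a a' : ℕ) :
    S c x A q v a a' =
      ∑ b ∈ (Finset.Icc 1 ⌊x / A⌋₊).filter (fun b : ℕ => b ≡ v [MOD q]),
        (ArithmeticFunction.liouville (Int.toNat ((a : ℤ) * b + c)) : ℝ) *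
          (ArithmeticFunction.liouville (Int.toNat ((a' : ℤ) * b + c)) : ℝ) := by
  rfl

/-! ### §2 The generic (Siegel-free) resistance theorem -/

/-- **`GenericUniformBinaryChowlaAP ⟹ DilatedTableChowla`.**  Hypothesis (written out): for every
`c ≠ 0` and `C > 0` there are `B, κ > 0` and `x₀` such that for `x ≥ x₀`, at every dilation
`1 ≤ q ≤ x^{1/24}` carrying the one-point data of the stub (C⁺) (`(log x)^B`-saving character sums of
`λ` to all moduli `n` with `q ∣ n`, `n ≤ q (log x)^κ`, on `x^{1/2} ≤ y ≤ x²`), the two-point sums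
`Σ_{b ≤ X, b ≡ v (q)} λ(ab+c) λ(a'b+c)` with `1 ≤ a ≠ a' ≤ 2x^{5/12}`, `a ≡ a' (mod q)`, `x^{7/12} ≤ X ≤ x` are
`≤ X/(q (log x)^C)` in absolute value.  Conclusion: the crux.  (Via the stub (C⁺) with empty
exceptional set and `Quarantine.dilatedTableChowla_of_genericAffineTable`.) [folklore] -/
theorem dilatedTableChowla_of_genericUniformBinaryChowlaAP
    (h : ∀ c : ℤ, c ≠ 0 → ∀ C : ℝ, 0 < C → ∃ B κ : ℝ, 0 < κ ∧ ∃ x₀ : ℝ, ∀ x : ℝ, x₀ ≤ x →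
      ∀ q : ℕ, 1 ≤ q → (q : ℝ) ≤ x ^ (1 / 24 : ℝ) →
        (∀ n : ℕ, q ∣ n → (n : ℝ) ≤ q * Real.log x ^ κ → ∀ [NeZero n],
          ∀ χ : DirichletCharacter ℂ n, ∀ y : ℝ, x ^ (1 / 2 : ℝ) ≤ y → y ≤ x ^ 2 →
            ‖∑ k ∈ Finset.Icc 1 ⌊y⌋₊, (ArithmeticFunction.liouville k : ℂ) * χ (k : ZMod n)‖ ≤
              y / Real.log x ^ B) →
        ∀ a a' v : ℕ, ∀ X : ℝ, 1 ≤ a → 1 ≤ a' → a ≠ a' → a ≡ a' [MOD q] →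
          (a : ℝ) ≤ 2 * x ^ (5 / 12 : ℝ) → (a' : ℝ) ≤ 2 * x ^ (5 / 12 : ℝ) →
          x ^ (7 / 12 : ℝ) ≤ X → X ≤ x →
            |∑ b ∈ (Finset.Icc 1 ⌊X⌋₊).filter (fun b : ℕ => b ≡ v [MOD q]),
                (ArithmeticFunction.liouville (Int.toNat ((a : ℤ) * b + c)) : ℝ) *
                  (ArithmeticFunction.liouville (Int.toNat ((a' : ℤ) * b + c)) : ℝ)| ≤
              X / ((q : ℝ) * Real.log x ^ C)) :
    DilatedTableChowla := by
  refine Quarantine.dilatedTableChowla_of_genericAffineTable ?_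
  intro c hc δ hδ hδ' C hC
  -- the hypothesis at exponent `C + 2`
  obtain ⟨B, κ, hκ, x₀, hx₀⟩ := h c hc (C + 2) (by linarith)
  -- room for the diagonal: `24 (log x)^C ≤ x^{δ/2}` eventually
  obtain ⟨x₂, hx₂⟩ := eventually_log_rpow_le 24 C (half_pos hδ)
  refine ⟨B, κ, hκ, max (max x₀ x₂) 64, fun x hx A hA1 hA2 u v => ?_⟩
  have hxx₀ : x₀ ≤ x := le_trans (le_trans (le_max_left _ _) (le_max_left _ _)) hx
  have hxx₂ : x₂ ≤ x := le_trans (le_trans (le_max_right _ _) (le_max_left _ _)) hx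
  have hx64 : 64 ≤ x := le_trans (le_max_right _ _) hx
  have hx1 : 1 ≤ x := by linarith
  have hxpos : 0 < x := by linarith
  have hL4 : 4 ≤ Real.log x := four_le_log_of_ge hx64
  have hLpos : 0 < Real.log x := by linarith
  have hL1 : 1 ≤ Real.log x := by linarith
  refine ⟨∅, ?_, fun q hq1 hq2 _ hOP => ?_⟩
  · rw [Finset.sum_empty]
    exact inv_nonneg.mpr (Real.rpow_nonneg hLpos.le C)
  set L : ℝ := Real.log x with hLdef
  -- window facts
  obtain ⟨hr, hcl, hqx, hqA, hAq, h1A⟩ := window_counts hδ hδ' hx1 hA1 hA2 hq1 hq2 (u q) (v q)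
  obtain ⟨hq24, hXlo, hXhi, hrows⟩ := window_real hδ hδ' hx1 hA1 hA2 hq2 (u q)
  have hApos : 0 < A := by linarith
  have hqpos : (0 : ℝ) < q := by exact_mod_cast hq1
  -- the two-point hypothesis at this dilation, with `X = x/A`
  have hS : ∀ a ∈ rows A q (u q), ∀ a' ∈ rows A q (u q), a ≠ a' →
      |S c x A q (v q) a a'| ≤ (x / A) / ((q : ℝ) * L ^ (C + 2)) := by
    intro a ha a' ha' hne
    obtain ⟨ha1, ha2⟩ := hrows a ha
    obtain ⟨ha1', ha2'⟩ := hrows a' ha'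
    have hmod : a ≡ a' [MOD q] := ((mem_rows.1 ha).2).trans ((mem_rows.1 ha').2).symm
    rw [S_eq_sum]
    exact hx₀ x hxx₀ q hq1 hq24 hOP a a' (v q) (x / A) ha1 ha1' hne hmod ha2 ha2' hXlo hXhi
  -- off-diagonal part
  have hoff : Foff c x A q (u q) (v q) ≤ (3 * A / q) ^ 2 * ((x / A) / ((q : ℝ) * L ^ (C + 2))) ^ 2 := by
    have h0 := Foff_le_of_offdiag c x A q (u q) (v q) hS
    refine h0.trans ?_
    gcongr
  -- diagonal part
  have hdiag : diagF c x A q (u q) (v q) ≤ (3 * A / q) * (2 * x / (A * q)) ^ 2 := by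
    have h0 := diagF_le c x A q (u q) (v q)
    refine h0.trans ?_
    gcongr
  -- assemble `q⁴ F`
  have hF : F c x A q (u q) (v q) = diagF c x A q (u q) (v q) + Foff c x A q (u q) (v q) :=
    F_eq_diag_add_off c x A q (u q) (v q)
  have hLC : 0 < L ^ C := Real.rpow_pos_of_pos hLpos C
  have hLC2 : L ^ (C + 2) = L ^ C * L ^ (2 : ℝ) := by
    rw [Real.rpow_add hLpos]
  have hL2 : (16 : ℝ) ≤ L ^ (2 : ℝ) := by
    rw [show (2 : ℝ) = (2 : ℕ) by norm_num, Real.rpow_natCast]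
    calc (16 : ℝ) = 4 ^ 2 := by norm_num
      _ ≤ L ^ 2 := pow_le_pow_left₀ (by norm_num) hL4 2
  -- (i) `q⁴ · diag ≤ 12 x² q / A ≤ 12 x² / x^{δ/2} ≤ x² / (2 L^C)`
  have hxd2 : 0 < x ^ (δ / 2) := Real.rpow_pos_of_pos hxpos _
  have hqA' : (q : ℝ) / A ≤ 1 / x ^ (δ / 2) := by
    rw [div_le_div_iff₀ hApos hxd2, one_mul]
    calc (q : ℝ) * x ^ (δ / 2) ≤ x ^ (δ / 2) * x ^ (δ / 2) := by gcongr
      _ = x ^ δ := by rw [← Real.rpow_add hxpos]; ring_nf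
      _ ≤ A := hA1
  have h24 : 24 * L ^ C ≤ x ^ (δ / 2) := hx₂ x hxx₂
  have hpart1 : (q : ℝ) ^ 4 * ((3 * A / q) * (2 * x / (A * q)) ^ 2) ≤ x ^ 2 / (2 * L ^ C) := by
    have e : (q : ℝ) ^ 4 * ((3 * A / q) * (2 * x / (A * q)) ^ 2) = 12 * x ^ 2 * ((q : ℝ) / A) := by
      field_simp; ring
    rw [e]
    calc 12 * x ^ 2 * ((q : ℝ) / A) ≤ 12 * x ^ 2 * (1 / x ^ (δ / 2)) := by gcongr
      _ ≤ 12 * x ^ 2 * (1 / (24 * L ^ C)) := by gcongr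
      _ = x ^ 2 / (2 * L ^ C) := by field_simp; ring
  -- (ii) `q⁴ · off ≤ 9 x² / L^{2C+4} ≤ x² / (2 L^C)`
  have hpart2 : (q : ℝ) ^ 4 * ((3 * A / q) ^ 2 * ((x / A) / ((q : ℝ) * L ^ (C + 2))) ^ 2) ≤
      x ^ 2 / (2 * L ^ C) := by
    have e : (q : ℝ) ^ 4 * ((3 * A / q) ^ 2 * ((x / A) / ((q : ℝ) * L ^ (C + 2))) ^ 2) =
        9 * x ^ 2 / (L ^ (C + 2)) ^ 2 := by
      field_simp
      norm_num
    rw [e, hLC2, div_le_div_iff₀ (by positivity) (by positivity)]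
    -- 9 x² · (2 L^C) ≤ x² · (L^C · L²)²  ⇐  18 L^C ≤ (L^C)² (L²)²
    have hLC1 : 1 ≤ L ^ C := Real.one_le_rpow hL1 hC.le
    have hsq1 : L ^ C ≤ (L ^ C) ^ 2 := by
      calc L ^ C = L ^ C * 1 := (mul_one _).symm
        _ ≤ L ^ C * L ^ C := mul_le_mul_of_nonneg_left hLC1 hLC.le
        _ = (L ^ C) ^ 2 := (sq _).symm
    have hsq2 : (256 : ℝ) ≤ (L ^ (2 : ℝ)) ^ 2 := by
      calc (256 : ℝ) = 16 ^ 2 := by norm_num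
        _ ≤ (L ^ (2 : ℝ)) ^ 2 := pow_le_pow_left₀ (by norm_num) hL2 2
    have hL2pos : 0 ≤ (L ^ (2 : ℝ)) ^ 2 := sq_nonneg _
    have hkey : 18 * L ^ C ≤ (L ^ C * L ^ (2 : ℝ)) ^ 2 := by
      calc 18 * L ^ C ≤ 256 * L ^ C := by
            apply mul_le_mul_of_nonneg_right (by norm_num) hLC.le
        _ ≤ (L ^ (2 : ℝ)) ^ 2 * L ^ C := mul_le_mul_of_nonneg_right hsq2 hLC.le
        _ ≤ (L ^ (2 : ℝ)) ^ 2 * (L ^ C) ^ 2 := mul_le_mul_of_nonneg_left hsq1 hL2pos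
        _ = (L ^ C * L ^ (2 : ℝ)) ^ 2 := by ring
    have hx2 : 0 ≤ x ^ 2 := sq_nonneg x
    calc 9 * x ^ 2 * (2 * L ^ C) = x ^ 2 * (18 * L ^ C) := by ring
      _ ≤ x ^ 2 * (L ^ C * L ^ (2 : ℝ)) ^ 2 := mul_le_mul_of_nonneg_left hkey hx2
  -- conclusion
  calc (q : ℝ) ^ 4 * (∑ a ∈ (Finset.Ioc ⌊A⌋₊ ⌊2 * A⌋₊).filter (fun a : ℕ => a ≡ u q [MOD q]),
          ∑ a' ∈ (Finset.Ioc ⌊A⌋₊ ⌊2 * A⌋₊).filter (fun a' : ℕ => a' ≡ u q [MOD q]),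
            (∑ b ∈ (Finset.Icc 1 ⌊x / A⌋₊).filter (fun b : ℕ => b ≡ v q [MOD q]),
              (ArithmeticFunction.liouville (Int.toNat ((a : ℤ) * b + c)) : ℝ) *
                (ArithmeticFunction.liouville (Int.toNat ((a' : ℤ) * b + c)) : ℝ)) ^ 2)
      = (q : ℝ) ^ 4 * F c x A q (u q) (v q) := rfl
    _ = (q : ℝ) ^ 4 * diagF c x A q (u q) (v q) + (q : ℝ) ^ 4 * Foff c x A q (u q) (v q) := by
        rw [hF]; ring
    _ ≤ (q : ℝ) ^ 4 * ((3 * A / q) * (2 * x / (A * q)) ^ 2) +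
        (q : ℝ) ^ 4 * ((3 * A / q) ^ 2 * ((x / A) / ((q : ℝ) * L ^ (C + 2))) ^ 2) := by
        gcongr
    _ ≤ x ^ 2 / (2 * L ^ C) + x ^ 2 / (2 * L ^ C) := add_le_add hpart1 hpart2
    _ = x ^ 2 / L ^ C := by field_simp; ring

/-! ### §3 The plain hypothesis, and the upper side of the sandwich -/

/-- **`UniformBinaryChowlaAP ⟹ DilatedTableChowla`** — the same two-point bound assumed at EVERY
dilation `q ≤ x^{1/24}` (no one-point antecedent): for every `c ≠ 0`, `C > 0`, beyond some `x₀`,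
`|Σ_{b ≤ X, b ≡ v (q)} λ(ab+c) λ(a'b+c)| ≤ X/(q (log x)^C)` uniformly for `1 ≤ q ≤ x^{1/24}`,
`1 ≤ a ≠ a' ≤ 2x^{5/12}` with `a ≡ a' (mod q)`, all classes `v`, `x^{7/12} ≤ X ≤ x`.  A fortiori from
`dilatedTableChowla_of_genericUniformBinaryChowlaAP` (take any `B`, `κ = 1`, ignore the data). [folklore] -/
theorem dilatedTableChowla_of_uniformBinaryChowlaAP
    (h : ∀ c : ℤ, c ≠ 0 → ∀ C : ℝ, 0 < C → ∃ x₀ : ℝ, ∀ x : ℝ, x₀ ≤ x →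
      ∀ q a a' v : ℕ, ∀ X : ℝ, 1 ≤ q → (q : ℝ) ≤ x ^ (1 / 24 : ℝ) → 1 ≤ a → 1 ≤ a' → a ≠ a' →
        a ≡ a' [MOD q] → (a : ℝ) ≤ 2 * x ^ (5 / 12 : ℝ) → (a' : ℝ) ≤ 2 * x ^ (5 / 12 : ℝ) →
        x ^ (7 / 12 : ℝ) ≤ X → X ≤ x →
          |∑ b ∈ (Finset.Icc 1 ⌊X⌋₊).filter (fun b : ℕ => b ≡ v [MOD q]),
              (ArithmeticFunction.liouville (Int.toNat ((a : ℤ) * b + c)) : ℝ) *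
                (ArithmeticFunction.liouville (Int.toNat ((a' : ℤ) * b + c)) : ℝ)| ≤
            X / ((q : ℝ) * Real.log x ^ C)) :
    DilatedTableChowla := by
  refine dilatedTableChowla_of_genericUniformBinaryChowlaAP ?_
  intro c hc C hC
  obtain ⟨x₀, hx₀⟩ := h c hc C hC
  exact ⟨0, 1, one_pos, x₀, fun x hx q hq1 hq24 _ a a' v X ha1 ha1' hne hmod ha2 ha2' hXlo hXhi =>
    hx₀ x hx q a a' v X hq1 hq24 ha1 ha1' hne hmod ha2 ha2' hXlo hXhi⟩

/-- **Upper side of the sandwich: `DilatedTableChowla ⟹ FixedResidueFace`.**  The crux implies its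
`q = 1` slice `TableChowla` (`Negative.crux_imp_tableChowla`), which implies the fixed-residue,
absolute-value level-of-distribution face for `λ` at level `x^{1−δ}` for every `δ ∈ (0, 1/12]`
(`TableChowla.Negative.fixedResidueFace_of_tableChowla`, p71931):
`Σ_{b ≤ x/A} |Σ_{a ∈ (A,2A]} λ(ab+c)| ≤ x/(log x)^C` — segments of `≍ A < x^{1/2}` terms, beyond the
reach of GRH. [folklore] -/
theorem fixedResidueFace_of_dilatedTableChowla (h : DilatedTableChowla) :
    TableChowla.Negative.FixedResidueFace :=
  TableChowla.Negative.fixedResidueFace_of_tableChowla (crux_imp_tableChowla h)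

end Summit.Parity.GeneralizedHardyLittlewood.Theorems.DilatedTableChowla.Resistance

end
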